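import Literature.AlgebraicGeometry.Resolution.ArithmeticalThreefoldsLocalDescentKeyed
import Literature.AlgebraicGeometry.Resolution.ArithmeticalThreefoldsLocalDescentInertiaTight
import Literature.AlgebraicGeometry.Resolution.HenselRootTrivialInertia
import HarnessLib

/-!
# Cossart–Piltant 2019, (C4) `CossartPiltant2019ReductionP`: the two stability hypotheses from ONE equivariant local uniformization

Topic: `Literature/AlgebraicGeometry/Resolution`. PROOF side of `CossartPiltant2019ReductionP`
(`ArithmeticalThreefoldsLocal.lean`), input (C4). The chain keyed on the printed facts,
`cossartPiltant2019ReductionP_of_printed_of_stableInertia`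
(`ArithmeticalThreefoldsLocalDescentKeyed.lean`), has exactly two hypotheses not found in
print, both EQUIVARIANT local uniformizations for a finite group fixing the valuation:

* `hStabLoc` — tame layer ([CoP1] Lemma 9.4, HAL hal-00139124 p. 29 l. 16: "Also `S` is stable
  by `G`, since any conjugate of `S` is dominated by `W`, hence equal to `S`"): for a Kummer
  step `A ≤ A(θ)` of prime degree `ℓ ≠ p` with `μ_ℓ ⊆ A` and inertia group all of
  `Gal(A(θ)|A)`, a local uniformization of `A(θ)` may be taken with `Gal(A(θ)|A)`-STABLE local
  ring;
* `hStabIη` — inertia layer (Cossart–Piltant 2019, arXiv v1 p. 54: "Proving that (LU vⁱ),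
  then (LU v) hold is an easy adaptation of [CoP1] proposition 9.3"): a local uniformization
  of the inertia field `Mⁱ` of `N | M` may be taken with `Gˢ`-stable local ring containing the
  henselian generator `η` of `Mⁱ = Mˢ(η)`.

This file derives BOTH from ONE statement `hEq` — equivariant local uniformization, with
cofinality, for a TAMELY acting group: for a subfield `M′ ∋ S` of the ambient algebraically
closed valued field `(E, O_E)` and a group `H` of `S`-automorphisms of `E` mapping `M′` into
itself and `O_E ∩ M′` into `O_E`, such that every `σ ∈ H` acting non-trivially on `M′` moves
some `x ∈ M′` by exactly `v(x)` (`v(σx − x) = v(x)`: no element of `H` acts on `M′` through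
the large ramification group, Zariski–Samuel VI §12 (17)), and a finite `s₀ ⊆ O_E ∩ M′`: if
`M′` has a local uniformization `S[t]`, `t ⊆ M′ ⊆ Frac(S)(t)`, then it has one whose local ring
at the centre of `O_E` is `H`-stable and contains `s₀`. So, along Cossart–Piltant's own
architecture, input (C4) of their Thm. 1.1 rests on four printed theorems and this single
statement:
`cossartPiltant2019ReductionP_of_printed_of_equivariantLU :
CossartPiltant2019Local → CossartPiltant2019Principalization → CossartJannsenSaito2020General →
CossartJannsenSaito2020Embedded → hEq → CossartPiltant2019ReductionP`.

Proof. Automorphisms of an intermediate field `N | M` (`M ∋ S` a subfield of `E`) extend to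
`S`-automorphisms of `E` (`E` is a normal extension of `M`, being algebraically closed and
algebraic over `S`; `AlgEquiv.liftNormal`): `exists_algEquiv_extends_of_isAlgClosed`. Tame layer: `H` = the
`S`-automorphisms of `E` restricting to an element of `Gal(A(θ)|A)` on `A(θ)`; they preserve
`O_E ∩ A(θ)` (inertia group `= ⊤`), and `τ ≠ 1` moves `θ` to `ζ^i θ` with `ζ^i ≠ 1`, so
`v(τθ − θ) = v(ζ^i − 1) v(θ) = v(θ)` as `v(ℓ) = 1` (`valuation_pow_sub_self_eq_one`). Inertia
layer: `H` = the `S`-automorphisms of `E` restricting to an element of `Gˢ` on `N`; they map `Mⁱ`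
into itself (`Gⁱ ⊲ Gˢ`, `map_mem_inertiaField_of_mem_decompositionGroupIn`) and preserve
`O_E ∩ Mⁱ`; an element acting non-trivially on `Mⁱ` restricts to `τ ∈ Gˢ ∖ Gⁱ`, which moves `η`
by a unit (`valuation_map_sub_eq_one_of_henselRoot_inertiaField`), whence the witness `η` (if
`v(η) = 1`) or `1 + η` (if `v(η) < 1`); cofinality with `s₀ = {η}` puts `η` in the local ring.

Everything is PROVED; no named facts, definitions, instances or notation are introduced. The
hypothesis `hEq` is NOT a published theorem (it is what the two printed sentences quoted above
silently use); it is a consequence, a posteriori, of Cossart–Piltant's Thm. 1.1 together with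
Cossart–Jannsen–Saito's canonical embedded resolution, Abhyankar's lemma and equivariant
resolution of log regular schemes (`IllusieTemkin2014_equivariantLogRegularResolution_holds`),
and it is the one statement a proof of (C4) along [CoP1] §9 has to supply.

## Sources

* V. Cossart, O. Piltant, J. Algebra 529 (2019) 268–535 = arXiv:1412.0868: proof of Prop. 4.10
  (arXiv v1: Prop. 4.8, pp. 53–54). [CossartPiltant2019]
* V. Cossart, O. Piltant, J. Algebra 320 (2008) 1051–1082: Prop. 9.3, Lemma 9.4 and their
  proofs (HAL hal-00139124, pp. 26–30). [CossartPiltant2008]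
* O. Zariski, P. Samuel, *Commutative Algebra* II (1960), Ch. VI §12 (decomposition, inertia
  and ramification groups). [ZariskiSamuel1960]
-/

noncomputable section

open CategoryTheory AlgebraicGeometry TopologicalSpace IsLocalRing _root_.Polynomial
  _root_.IntermediateField

namespace Literature.AlgebraicGeometry.Resolution

universe u

/-! ## Extending automorphisms of subextensions to the algebraically closed ambient field -/

section Tools

variable {S E : Type u} [CommRing S] [Field E] [Algebra S E]

/-- If `E` is algebraic over `S`, it is algebraic over every subfield `M ∋ S`. [folklore] -/
private theorem isAlgebraic_subfield_of_isAlgebraic [Algebra.IsAlgebraic S E]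
    (hinj : Function.Injective (algebraMap S E)) (M : Subfield E)
    (hSM : ∀ s : S, algebraMap S E s ∈ M) : Algebra.IsAlgebraic M E := by
  refine ⟨fun e => ?_⟩
  obtain ⟨q, hq0, hqe⟩ := Algebra.IsAlgebraic.isAlgebraic (R := S) e
  let f : S →+* M := (algebraMap S E).codRestrict M hSM
  have hf : Function.Injective f := by
    intro a b hab
    apply hinj
    have h := congrArg (fun z : M => (z : E)) hab
    exact h
  have hcomp : (algebraMap M E).comp f = algebraMap S E := RingHom.ext fun _ => rfl
  refine ⟨q.map f, (Polynomial.map_ne_zero_iff hf).mpr hq0, ?_⟩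
  rw [Polynomial.aeval_def, Polynomial.eval₂_map, hcomp]
  rwa [Polynomial.aeval_def] at hqe

/-- **Automorphisms of subextensions extend to the ambient algebraically closed field**: for a
subfield `M ∋ S` of `E` (algebraically closed, algebraic over `S`), an intermediate field
`N | M` and `τ ∈ Aut_M(N)`, some `S`-automorphism `σ` of `E` restricts to `τ` on `N` (`E | M`
is normal; `AlgEquiv.liftNormal`). [folklore] -/
private theorem exists_algEquiv_extends_of_isAlgClosed [IsAlgClosed E] [Algebra.IsAlgebraic S E]
    (hinj : Function.Injective (algebraMap S E)) (M : Subfield E)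
    (hSM : ∀ s : S, algebraMap S E s ∈ M) (N : IntermediateField M E) (τ : N ≃ₐ[M] N) :
    ∃ σ : E ≃ₐ[S] E, ∀ x : N, σ (x : E) = ((τ x : N) : E) := by
  haveI : Algebra.IsAlgebraic M E := isAlgebraic_subfield_of_isAlgebraic hinj M hSM
  haveI : IsAlgClosure M E :=
    { isAlgClosed := ‹IsAlgClosed E›, isAlgebraic := ‹Algebra.IsAlgebraic M E› }
  haveI : Normal M E := IsAlgClosure.normal M E
  let σ₀ : E ≃ₐ[M] E := τ.liftNormal E
  have hσ₀S : ∀ s : S, σ₀.toRingEquiv (algebraMap S E s) = algebraMap S E s := fun s =>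
    σ₀.commutes (⟨algebraMap S E s, hSM s⟩ : M)
  refine ⟨AlgEquiv.ofRingEquiv hσ₀S, fun x => ?_⟩
  exact AlgEquiv.liftNormal_commutes τ E x

end Tools

/-! ## The chain for (C4) from one equivariant local uniformization -/

set_option maxHeartbeats 1600000 in
/-- **The chain for (C4), keyed on the printed facts, from ONE equivariant local
uniformization.** The local theorem (CP 2019 Thm. 1.5), principalization (Prop. 4.4),
Cossart–Jannsen–Saito Thm. 1.2 and Thm. 1.4 (`B = ∅`), and equivariant local uniformization
with cofinality for tamely acting finite groups of automorphisms fixing the valuation (`hEq`: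
frame `S ⊆ (E, O_E)` as in the chain; `M′ ∋ S` a subfield; `H` a group of `S`-automorphisms
of `E` mapping `M′` into itself and `O_E ∩ M′` into `O_E`, each element acting non-trivially on
`M′` moving some `x ∈ M′` by exactly `v(x)`; `s₀ ⊆ O_E ∩ M′` finite; a local uniformization of
`M′` gives one with `H`-stable local ring containing `s₀`) give `CossartPiltant2019ReductionP`:
`hEq` implies "`S` is stable by `G`" in the tame layer ([CoP1] Lemma 9.4) and the stable local
uniformization of the inertia field containing its henselian generator (the inertia-layer
descent, CP 2019 p. 54), the two inputs of `cossartPiltant2019ReductionP_of_printed_of_stableInertia`.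
[cite: CossartPiltant2019, proof of Prop. 4.10 (arXiv v1: Prop. 4.8, pp. 53–54)]
[cite: CossartPiltant2008, Prop. 9.3, Lemma 9.4 and their proofs (HAL pp. 26–30)]
[cite: ZariskiSamuel1960, Ch. VI §12 (17)] -/
theorem cossartPiltant2019ReductionP_of_printed_of_equivariantLU
    (hloc : CossartPiltant2019Local.{u}) (h44 : CossartPiltant2019Principalization.{u})
    (hCJS : CossartJannsenSaito2020General.{u}) (hCJSE : CossartJannsenSaito2020Embedded.{u})
    (hEq :
      ∀ (p : ℕ), p.Prime →
      ∀ (S : Type u) [CommRing S] [IsDomain S] [IsRegularLocalRing S],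
        IsExcellentRing S → ringKrullDim S = 3 → CharP (ResidueField S) p →
        IsAdicComplete (maximalIdeal S) S →
      ∀ (E : Type u) [Field E] [Algebra S E], Function.Injective (algebraMap S E) →
        IsAlgClosed E → Algebra.IsAlgebraic S E →
      ∀ (OE : ValuationSubring E), (∀ s : S, algebraMap S E s ∈ OE) →
        (∀ s ∈ maximalIdeal S, OE.valuation (algebraMap S E s) < 1) →
        (∀ y : OE, ∃ q : S[X], (∃ i, q.coeff i ∉ maximalIdeal S) ∧
          OE.valuation (q.eval₂ (algebraMap S E) y) < 1) →
      Nonempty OE.valuation.RankOne →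
      ∀ (M' : Subfield E), (∀ s : S, algebraMap S E s ∈ M') →
      ∀ (H : Subgroup (E ≃ₐ[S] E)),
        (∀ σ ∈ H, ∀ x ∈ M', σ x ∈ M') →
        (∀ σ ∈ H, ∀ x ∈ M', x ∈ OE → σ x ∈ OE) →
        (∀ σ ∈ H, (∃ x ∈ M', σ x ≠ x) →
          ∃ x ∈ M', x ≠ 0 ∧ OE.valuation (σ x - x) = OE.valuation x) →
      ∀ (s₀ : Finset E), (s₀ : Set E) ⊆ M' → (∀ x ∈ s₀, x ∈ OE) →
        (∃ t : Finset E, (t : Set E) ⊆ M' ∧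
          M' ≤ Subfield.closure (Set.range (algebraMap S E) ∪ (t : Set E)) ∧
          ∃ hTO : (Algebra.adjoin S (t : Set E)).toSubring ≤ OE.toSubring,
            IsRegularLocalRing (Localization.AtPrime
              (Ideal.comap (Subring.inclusion hTO) (maximalIdeal OE)))) →
        ∃ t : Finset E, (t : Set E) ⊆ M' ∧
          M' ≤ Subfield.closure (Set.range (algebraMap S E) ∪ (t : Set E)) ∧
          ∃ hTO : (Algebra.adjoin S (t : Set E)).toSubring ≤ OE.toSubring,
            IsRegularLocalRing (Localization.AtPrime
              (Ideal.comap (Subring.inclusion hTO) (maximalIdeal OE))) ∧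
            (∀ σ ∈ H, ∀ x ∈ locAtCentre (Algebra.adjoin S (t : Set E)).toSubring OE,
              σ x ∈ locAtCentre (Algebra.adjoin S (t : Set E)).toSubring OE) ∧
            (s₀ : Set E) ⊆ locAtCentre (Algebra.adjoin S (t : Set E)).toSubring OE) :
    CossartPiltant2019ReductionP.{u} := by
  classical
  refine cossartPiltant2019ReductionP_of_printed_of_stableInertia hloc h44 hCJS hCJSE ?_ ?_
  · -- TAME LAYER: "S is stable by G" ([CoP1] Lemma 9.4)
    intro p hp S _ _ _ hSexc hSdim hSchar hScomp E _ _ hinj hE halg OE hSO hdom hres hrk ℓ hℓ hℓp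
      ζ hζ A hSA hζA θ hθA hθℓ hvθ hfin hgal hinert hLU
    haveI : Fact p.Prime := ⟨hp⟩
    have hℓ0 : ℓ ≠ 0 := hℓ.ne_zero
    haveI : NeZero ℓ := ⟨hℓ0⟩
    -- residue characteristic and `v(ℓ) = 1`
    haveI hchar : CharP (ResidueField OE) p :=
      charP_residueField_valuationSubring_of_dominates OE p hSchar hSO hdom
    have hvℓ : OE.valuation (ℓ : E) = 1 := by
      have hres0 : (ℓ : ResidueField OE) ≠ 0 := by
        intro h0
        have h1 : p ∣ ℓ := (CharP.cast_eq_zero_iff (ResidueField OE) p ℓ).mp h0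
        exact hℓp ((Nat.prime_dvd_prime_iff_eq hp hℓ).mp h1).symm
      have hnotmem : (ℓ : OE) ∉ maximalIdeal OE := fun hmem => hres0 (by
        rw [← map_natCast (IsLocalRing.residue OE) ℓ, IsLocalRing.residue_eq_zero_iff]
        exact hmem)
      have h1 : OE.valuation ((ℓ : OE) : E) = 1 := by
        have hle : OE.valuation ((ℓ : OE) : E) ≤ 1 := (OE.valuation_le_one_iff _).mpr (ℓ : OE).2
        have hnlt : ¬ OE.valuation ((ℓ : OE) : E) < 1 := fun hlt =>
          hnotmem ((ValuationSubring.valuation_lt_one_iff OE _).mpr hlt)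
        exact le_antisymm hle (not_lt.mp hnlt)
      rwa [show ((ℓ : OE) : E) = (ℓ : E) from map_natCast OE.subtype ℓ] at h1
    have hθ0 : θ ≠ 0 := fun h => hθA (h ▸ A.zero_mem)
    set K₀ : IntermediateField A E := adjoin A ({θ} : Set E) with hK₀def
    have hθK : θ ∈ K₀ := mem_adjoin_simple_self A θ
    have hSK : ∀ s : S, algebraMap S E s ∈ K₀.toSubfield := fun s =>
      K₀.algebraMap_mem (⟨algebraMap S E s, hSA s⟩ : A)
    -- every `τ ∈ Gal(A(θ)|A)` multiplies `θ` by an `ℓ`-th root of unity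
    have hroot : ∀ τ : K₀ ≃ₐ[A] K₀, ∃ i, ((τ ⟨θ, hθK⟩ : K₀) : E) = ζ ^ i * θ := by
      intro τ
      set y : K₀ := ⟨θ, hθK⟩ with hy
      have hyℓ : y ^ ℓ = algebraMap A K₀ ⟨θ ^ ℓ, hθℓ⟩ := Subtype.ext (by
        rw [SubmonoidClass.coe_pow]; rfl)
      have hτy : ((τ y : K₀) : E) ^ ℓ = θ ^ ℓ := by
        have h1 : τ (y ^ ℓ) = τ y ^ ℓ := map_pow τ y ℓ
        rw [hyℓ, AlgEquiv.commutes] at h1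
        have h2 := congrArg (fun z : K₀ => (z : E)) h1
        simp only [SubmonoidClass.coe_pow] at h2
        rw [← h2]
        rfl
      have h1 : (((τ y : K₀) : E) / θ) ^ ℓ = 1 := by
        rw [div_pow, hτy, div_self (pow_ne_zero _ hθ0)]
      obtain ⟨i, -, hi⟩ := hζ.eq_pow_of_pow_eq_one h1
      exact ⟨i, by rw [hi, div_mul_cancel₀ _ hθ0]⟩
    -- an element of `Gal(A(θ)|A)` fixing `θ` is the identity
    have htriv : ∀ τ : K₀ ≃ₐ[A] K₀, ((τ ⟨θ, hθK⟩ : K₀) : E) = θ → ∀ x : K₀, τ x = x := by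
      intro τ hτθ x
      have hτ1 : τ = 1 := by
        apply AlgEquiv.coe_toAlgHom_injective
        refine IntermediateField.adjoin_algHom_ext A fun z hz => Subtype.ext ?_
        rw [Set.mem_singleton_iff] at hz
        subst hz
        rw [AlgEquiv.coe_toAlgHom, AlgEquiv.coe_toAlgHom, AlgEquiv.one_apply]
        exact hτθ
      rw [hτ1, AlgEquiv.one_apply]
    -- the group of `S`-automorphisms of `E` restricting to `Gal(A(θ)|A)`
    let H : Subgroup (E ≃ₐ[S] E) :=
      { carrier := {σ | ∃ τ : K₀ ≃ₐ[A] K₀, ∀ x : K₀, σ (x : E) = ((τ x : K₀) : E)}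
        one_mem' := ⟨1, fun x => rfl⟩
        mul_mem' := by
          rintro σ₁ σ₂ ⟨τ₁, h₁⟩ ⟨τ₂, h₂⟩
          refine ⟨τ₁ * τ₂, fun x => ?_⟩
          rw [AlgEquiv.mul_apply, AlgEquiv.mul_apply, h₂ x, h₁ (τ₂ x)]
        inv_mem' := by
          rintro σ ⟨τ, h⟩
          refine ⟨τ⁻¹, fun x => ?_⟩
          rw [AlgEquiv.aut_inv, AlgEquiv.aut_inv, AlgEquiv.symm_apply_eq, h (τ.symm x),
            AlgEquiv.apply_symm_apply] }
    have hH1 : ∀ σ ∈ H, ∀ x ∈ K₀.toSubfield, σ x ∈ K₀.toSubfield := by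
      rintro σ ⟨τ, hτ⟩ x hx
      rw [hτ ⟨x, hx⟩]
      exact (τ ⟨x, hx⟩).2
    have hH2 : ∀ σ ∈ H, ∀ x ∈ K₀.toSubfield, x ∈ OE → σ x ∈ OE := by
      rintro σ ⟨τ, hτ⟩ x hx hxO
      have hτi : τ ∈ inertiaGroupIn OE K₀ := by rw [hinert]; exact Subgroup.mem_top τ
      rw [hτ ⟨x, hx⟩]
      exact (((mem_inertiaGroupIn_iff OE K₀ τ).mp hτi).1 ⟨x, hx⟩).mp hxO
    have hH3 : ∀ σ ∈ H, (∃ x ∈ K₀.toSubfield, σ x ≠ x) →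
        ∃ x ∈ K₀.toSubfield, x ≠ 0 ∧ OE.valuation (σ x - x) = OE.valuation x := by
      rintro σ ⟨τ, hτ⟩ ⟨x, hx, hne⟩
      obtain ⟨i, hi⟩ := hroot τ
      refine ⟨θ, hθK, hθ0, ?_⟩
      rw [hτ ⟨θ, hθK⟩, hi]
      by_cases h1 : ζ ^ i = 1
      · exfalso
        apply hne
        rw [hτ ⟨x, hx⟩]
        exact congrArg Subtype.val (htriv τ (by rw [hi, h1, one_mul]) ⟨x, hx⟩)
      · have hζi : (ζ ^ i) ^ ℓ = 1 := by
          rw [← pow_mul, mul_comm, pow_mul, hζ.pow_eq_one, one_pow]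
        have h2 := valuation_pow_sub_self_eq_one OE hvℓ (one_pow ℓ) hζi
          (by rw [mul_one]; exact h1)
        rw [mul_one] at h2
        rw [show ζ ^ i * θ - θ = (ζ ^ i - 1) * θ by ring, map_mul, h2, one_mul]
    obtain ⟨t, htK, hKle, hTO, hreg, hstab, -⟩ := hEq p hp S hSexc hSdim hSchar hScomp E hinj hE
      halg OE hSO hdom hres hrk K₀.toSubfield hSK H hH1 hH2 hH3 ∅ (by simp) (by simp) hLU
    refine ⟨t, htK, hKle, hTO, hreg, fun τ x hx => ?_⟩
    obtain ⟨σ, hσ⟩ := exists_algEquiv_extends_of_isAlgClosed hinj A hSA K₀ τ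
    have hσH : σ ∈ H := ⟨τ, hσ⟩
    rw [← hσ x]
    exact hstab σ hσH _ hx
  · -- INERTIA LAYER: the stable local uniformization of `Mⁱ` containing `η`
    intro p hp S _ _ _ hSexc hSdim hSchar hScomp E _ _ hinj hE halg OE hSO hdom hres hrk M hSM
      N _ _ η hηV hηI hF hgen hLU
    obtain ⟨F, hFmon, hFcoeff, hFη, hF'⟩ := hF
    set Mi : Subfield E := (lift (fixedField (inertiaGroupIn OE N))).toSubfield with hMidef
    have hMiN : ∀ x ∈ Mi, x ∈ N := fun x hx => lift_le _ (show x ∈ lift _ from hx)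
    have hηN : η ∈ N := hMiN η hηI
    have hSMi : ∀ s : S, algebraMap S E s ∈ Mi := fun s => le_lift_toSubfield _ (hSM s)
    -- the group of `S`-automorphisms of `E` restricting to `Gˢ` on `N`
    let H : Subgroup (E ≃ₐ[S] E) :=
      { carrier := {σ | ∃ τ ∈ decompositionGroupIn OE N, ∀ x : N, σ (x : E) = ((τ x : N) : E)}
        one_mem' := ⟨1, one_mem _, fun x => rfl⟩
        mul_mem' := by
          rintro σ₁ σ₂ ⟨τ₁, hτ₁, h₁⟩ ⟨τ₂, hτ₂, h₂⟩
          refine ⟨τ₁ * τ₂, mul_mem hτ₁ hτ₂, fun x => ?_⟩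
          rw [AlgEquiv.mul_apply, AlgEquiv.mul_apply, h₂ x, h₁ (τ₂ x)]
        inv_mem' := by
          rintro σ ⟨τ, hτ, h⟩
          refine ⟨τ⁻¹, inv_mem hτ, fun x => ?_⟩
          rw [AlgEquiv.aut_inv, AlgEquiv.aut_inv, AlgEquiv.symm_apply_eq, h (τ.symm x),
            AlgEquiv.apply_symm_apply] }
    have hH1 : ∀ σ ∈ H, ∀ x ∈ Mi, σ x ∈ Mi := by
      rintro σ ⟨τ, hτs, hτ⟩ x hx
      rw [hτ ⟨x, hMiN x hx⟩]
      exact map_mem_inertiaField_of_mem_decompositionGroupIn OE N hx hτs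
    have hH2 : ∀ σ ∈ H, ∀ x ∈ Mi, x ∈ OE → σ x ∈ OE := by
      rintro σ ⟨τ, hτs, hτ⟩ x hx hxO
      rw [hτ ⟨x, hMiN x hx⟩]
      exact (((mem_decompositionGroupIn_iff OE N τ).mp hτs) ⟨x, hMiN x hx⟩).mp hxO
    have hH3 : ∀ σ ∈ H, (∃ x ∈ Mi, σ x ≠ x) →
        ∃ x ∈ Mi, x ≠ 0 ∧ OE.valuation (σ x - x) = OE.valuation x := by
      rintro σ ⟨τ, hτs, hτ⟩ ⟨x, hx, hne⟩
      have hτi : τ ∉ inertiaGroupIn OE N := by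
        intro hτi
        apply hne
        rw [hτ ⟨x, hMiN x hx⟩]
        have hxfix : (⟨x, hMiN x hx⟩ : N) ∈ fixedField (inertiaGroupIn OE N) :=
          (IntermediateField.mem_lift (⟨x, hMiN x hx⟩ : N)).mp hx
        exact congrArg Subtype.val ((mem_fixedField_iff _ _).mp hxfix τ hτi)
      have hunit := valuation_map_sub_eq_one_of_henselRoot_inertiaField OE N hηV hηN F hFmon
        hFcoeff hFη hF' hgen hτs hτi
      by_cases hvη : OE.valuation η = 1
      · refine ⟨η, hηI, fun h0 => ?_, ?_⟩
        · rw [h0, map_zero] at hvη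
          exact zero_ne_one hvη
        · rw [hτ ⟨η, hηN⟩, hunit, hvη]
      · have hlt : OE.valuation η < 1 :=
          lt_of_le_of_ne ((OE.valuation_le_one_iff η).mpr hηV) hvη
        have h1η : OE.valuation (1 + η) = 1 := Valuation.map_one_add_of_lt _ hlt
        refine ⟨1 + η, add_mem (one_mem _) hηI, fun h0 => ?_, ?_⟩
        · rw [h0, map_zero] at h1η
          exact zero_ne_one h1η
        · rw [map_add, map_one, hτ ⟨η, hηN⟩, h1η,
            show (1 : E) + ((τ ⟨η, hηN⟩ : N) : E) - (1 + η) = ((τ ⟨η, hηN⟩ : N) : E) - η by ring,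
            hunit]
    have hs₀ : ((({η} : Finset E)) : Set E) ⊆ Mi := by
      rw [Finset.coe_singleton, Set.singleton_subset_iff]
      exact hηI
    have hs₀O : ∀ x ∈ ({η} : Finset E), x ∈ OE := by
      intro x hx
      rw [Finset.mem_singleton] at hx
      rw [hx]
      exact hηV
    obtain ⟨t, htK, hKle, hTO, hreg, hstab, hηT⟩ := hEq p hp S hSexc hSdim hSchar hScomp E hinj
      hE halg OE hSO hdom hres hrk Mi hSMi H hH1 hH2 hH3 {η} hs₀ hs₀O hLU
    refine ⟨t, htK, hKle, hTO, hreg, fun τ hτs x hx => ?_, ?_⟩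
    · obtain ⟨σ, hσ⟩ := exists_algEquiv_extends_of_isAlgClosed hinj M hSM N τ
      have hσH : σ ∈ H := ⟨τ, hτs, hσ⟩
      rw [← hσ x]
      exact hstab σ hσH _ hx
    · rw [Finset.coe_singleton, Set.singleton_subset_iff] at hηT
      exact hηT

end Literature.AlgebraicGeometry.Resolution

end
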